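import Summits.BirchSwinnertonDyer.BirchSwinnertonDyer.Theorems.GoldfeldAllTwistsTwoConverseTwinQuarterTraceIndexB4ThreeModEightPlusAlphaSharp
import Summits.BirchSwinnertonDyer.BirchSwinnertonDyer.Theorems.GoldfeldAllTwistsTwoConverseTwinQuarterTraceIndexB4PlusAlphaSharp
import HarnessLib

set_option linter.dupNamespace false -- namespace `…BirchSwinnertonDyer.BirchSwinnertonDyer…` is the cell's (D-0017 nested layout)
set_option autoImplicit false

/-!
# OBJECT A3⁺, optional capstone U⁺-αF: `BSD(W, 2)` on EVERY type-α two-prime cell with `(p/q) = +1` — A7⁺ ∪ A3⁺ = a71+ ∪ a75+ ∪ a31+ ∪ a35+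
# (`q ≡ 3 (mod 4)`, `q > 3`) as ONE statement, by cases on `q mod 8`, by name

Cell `bsd-goldfeld`, seat `bsd-goldfeld-s1p-c3x` (gen 17). The formula-axis sibling of object 6 (`…QuarterTraceAlphaPlusModFourUnion`, RULING (cdiv) (β)): ONE by-name
theorem, `q ≡ 7 (mod 8)` ↦ A7⁺'s F⁺-3 `bsdp_two_negTwoPrimesTwist_alphaPlus_modFour_of_print_sharp` (SEVENTEEN inputs: needs `hBCST`/`hpar` for its `h2`),
`q ≡ 3 (mod 8)` ↦ F8 `bsdp_two_negTwoPrimesTwist_alphaThreeModEightPlus_of_print_sharp` (FIFTEEN inputs). Allow-list = the SEVENTEEN exactly; no new content.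
`--supports stmt-BirchSwinnertonDyer-19140` as a HELPER (formula axis). Theses-free; ONE theorem; no definition, no new fact, no `sorry`, no kit.
HONEST FRAMING: a WITNESS FAMILY of twist-density ZERO modulo named print (SELMER-DRIFT ceiling); FRONTIER-grade, never distance-to-summit; twin″ (item 19140)
is NOT closed; BSD is not proved by any of this.
-/

noncomputable section

open scoped Classical

open WeierstrassCurve NumberField Literature.NumberTheory Literature.NumberTheory.EllipticCurves
  Literature.NumberTheory.EllipticCurves.ModularForms Literature.NumberTheory.EllipticCurves.CaiShuTian2014
  Literature.NumberTheory.EllipticCurves.CoatesLiTianZhai2015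

namespace Summit.BirchSwinnertonDyer.BirchSwinnertonDyer.Theorems.GoldfeldGoodTwists

section UnionAlphaPlusFormula

variable (hCST : thm11_ringClassChar)
  (hGZ : ∀ (N : ℕ) [NeZero N] (W : WeierstrassCurve ℚ) (K : Type) [Field K] [NumberField K], gross_zagier N W K)
  (h12 : thm12_fullBSD_twist) (h44 : thm44_ord_two_LAlg) (h14 : thm14_rankOne_twist)
  (hS31 : bsdTriple_of_rank_le_one_of_conductor_lt) (hnew : exists_isNewformOf) (hM : OptimalCurveManinCertificate cm7)
  (hBT : burungaleTian_analyticRank_eq_zero_of_selmerCorank_eq_zero_of_hasCM) (hBF : bsdTriple_of_hasCM_of_L_one_ne_zero)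
  (hGZK : rank_eq_analyticRank_of_analyticRank_le_one) (hEta : x049_heegner_norm_x_sub_two_not_mem)
  (hEta₀ : x049_x_sub_two_eq_etaQuotient) (hD : deuring_etaQuotient49_heegner_generates_conjPrime)
  (hBCST : BurungaleCastellaSkinnerTian2022.thmA_analyticRank_eq_one_of_selmerCorank_eq_one)
  (hpar : ∀ (V : WeierstrassCurve ℚ) [V.IsElliptic], p_parity V 2)
  (hKo : ∀ (N : ℕ) [NeZero N] (W : WeierstrassCurve ℚ) (K : Type) [Field K] [NumberField K], kolyvagin N W K)
include hCST hGZ h12 h44 h14 hS31 hnew hM hBT hBF hGZK hEta hEta₀ hD hBCST hpar hKo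

/-- **`BSD(W, 2)` ON EVERY type-α two-prime cell with `(p/q) = +1`, FROM PRINT + KOLYVAGIN**: for primes `q > 3`, `q ≡ 3 (mod 4)`, `(q/7) = −1`, and
`p ≡ 1 (mod 4)`, `(−7/p) = +1`, `−7` NOT a fourth power mod `p`, with `(p/q) = +1`, and EVERY globally minimal elliptic `W/ℚ` with `C • W = X₀(49)^{(−2qp)}`:
`BSD(W, 2)` — by cases on `q mod 8` onto A7⁺'s F⁺-3 (lift `σ̃_q`, needs `hBCST`/`hpar`) ∣ F8 (lift `σ̃_p`, needs neither). SEVENTEEN named inputs, nothing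
else; NO Cassels–Tate, NO `h13`. Twist-density ZERO; not a closer of any item; BSD is not proved.
[cite: GrossZagier1986, Thm. I.(6.3)] [cite: Gross1984, §§4–5] [cite: CoatesLiTianZhai2015, Thm. 1.2, 1.4 and 4.4] [cite: BurungaleCastellaSkinnerTian2022, Thm. A (p. 326)] -/
theorem bsdp_two_negTwoPrimesTwist_alphaPlus_threeModFour_of_print_sharp
    {q p : ℕ} (hq : q.Prime) (h3 : 3 < q) (hq4 : q % 4 = 3) (hq7 : jacobiSym q 7 = -1)
    [Fact p.Prime] (hp4 : p % 4 = 1) (hp7 : legendreSym p (-7) = 1) (hα : ¬ ∃ x : ZMod p, x ^ 4 = -7) (hpq : jacobiSym (p : ℤ) q = 1)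
    (W : WeierstrassCurve ℚ) [W.IsElliptic] [W.IsGloballyMinimal] (C : VariableChange ℚ)
    (hC : C • W = cm7.quadraticTwist (-(2 * (q : ℚ) * p))) : BSDp W 2 := by
  obtain hq8 | hq8 : q % 8 = 3 ∨ q % 8 = 7 := by omega
  · exact bsdp_two_negTwoPrimesTwist_alphaThreeModEightPlus_of_print_sharp hCST hGZ h12 h44 h14 hS31 hnew hM hBT hBF hGZK hEta hEta₀ hD hKo hq hq8 h3
      hq7 hp4 hp7 hα hpq W C hC
  · exact bsdp_two_negTwoPrimesTwist_alphaPlus_modFour_of_print_sharp hCST hGZ h12 h44 h14 hS31 hnew hM hBT hBF hGZK hEta hEta₀ hD hBCST hpar hKo hq hq8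
      hq7 hp4 hp7 hα hpq W C hC

end UnionAlphaPlusFormula

end Summit.BirchSwinnertonDyer.BirchSwinnertonDyer.Theorems.GoldfeldGoodTwists

end
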